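import Literature.AlgebraicGeometry.Frobenioids.MotivatingExamplesSub
import Literature.AlgebraicGeometry.Frobenioids.ArithmeticDivisorsPerfFactorial
import HarnessLib

/-!
# Frobenioids I, Thm. 6.4 (i) / Ex. 6.3 — sub-DAG row T64i/L02 «`Φ` is perf-factorial» DISCHARGED

Mochizuki, *The geometry of Frobenioids I*, Kyushu J. Math. **62** (2008), Thm. 6.4 (i), kurims p. 115
l. 15–16 ("`Φ` is nonzero and perf-factorial") and Ex. 6.3 p. 113 l. 13 ("Thus [cf. §0], `Φ(L)` (`≠ 0`) is
perf-factorial") [cite: MochizukiFrdI2008, Thm. 6.4 (i) p.115] [cite: MochizukiFrdI2008, Ex. 6.3 p.113].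

The named statement `Thm64i_L02_perfFactorial` of the sub-DAG statements file (`MotivatingExamplesSub.lean`,
seat abc-iut-L1-t1; plan/L1/SUBDAG-FrdI-Thm64.md row T64i/L02, holder abc-iut-L6-t10 who released it to
abc-iut-L1-d2) is PROVED by `EffArithDivisor.isPerfFactorial` (`ArithmeticDivisorsPerfFactorial.lean`:
`Φ(L) ≅ ⊕_{v ∈ V(L)} Λ_v`, a direct sum of monoprime monoids, is perf-factorial — `DirectSum.isPerfFactorial`).
Proof-only companion.  Seat abc-iut-L1-d2 (cell abc-iut).
-/

namespace Literature.AlgebraicGeometry.Frobenioids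

/-- **Sub-DAG row FrdI:Thm6.4(i)/T64i-L02 DISCHARGED**: every `Φ(L)`, `L` a number field, is
perf-factorial. [cite: MochizukiFrdI2008, Thm. 6.4 (i) p.115] -/
theorem Thm64i_L02_perfFactorial_holds : Thm64i_L02_perfFactorial :=
  fun L _ _ => EffArithDivisor.isPerfFactorial L

end Literature.AlgebraicGeometry.Frobenioids
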